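import Mathlib
import Summits.Ventures.PercRepro2.ThreeMarkPointSplit

/-!
# (3M1): the second point-split form on the (3M) data — `ThreeMarkOne`, its cell form, and the
reduction from `PointSplitBHKOne`
(blind cell PercRepro2, night-3 g23, 2026-08-28; `proofs/NIGHT3-CERT.md` §32.3)

The second point-split form `M(1_{v ∈ C₂}, 1)` of `PointSplitBHK.lean`, evaluated on the (3M) data
(`s = a₂`, `X = Y = {a₁}`, `F = 1 − g_b`, `G = 1_{o ∈ ·}`), is a NEW 5-mark inequality in g21's cells
`m(χ, ω, β) = P(Q, [v ∈ C(a₂)] = χ, [o ∈ C(a₂)] = ω, [b ∈ C(a₁)] = β)`: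

  **(3M1)**  `m(101)m(010) + m(001)m(110) + 2·m(110)m(101) ≥ m(011)m(100) + m(111)m(000) + 2·m(100)m(111)`,

i.e. **(3M1) = (3M) + 2·[m(110)m(101) − m(100)m(111)]** (`threeMarkOne_slack_eq`), the bracket being
the BHK slack of the pair `(h, o)` restricted to the class `{v ∈ C(a₂)}` (NOT signed: negative on
10 / 500 random instances, and on 16 abstract instances with ≤ 6 mixed edges in the typed census).
Census (night-3 g23, exact): (3M1) 0 failures / 913 random instances (distinct or coincident marks);
typed coefficients 0 negative on all 1,362,083 abstract instances with ≤ 6 mixed edges (g22's model,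
own code `tm1_abstr.c`).  `threeMarkOne_of_pointSplitBHKOne`: (PS1) at `a₂` implies (3M1) for every
marking; by the pendant-edge derivative (§32.3, paper) (PS1) on all instances implies (3M) on all
instances.  Own work; standard axioms.
-/

namespace Summit.Ventures.PercRepro2

open UnionCluster

namespace CovForm

namespace PointSplit

open RootEdge

variable {V : Type*} {E : Type*} [Fintype E] [DecidableEq E]
  {R : Type*} [Field R] [LinearOrder R] [IsStrictOrderedRing R]

/-- **(3M1), a CANDIDATE (NOT claimed proved)**: the second point-split form on the (3M) data,
`m(011)m(100) + m(111)m(000) + 2·m(100)m(111) ≤ m(101)m(010) + m(001)m(110) + 2·m(110)m(101)`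
for every product law.  Equals (3M) plus twice the `{v ∈ C(a₂)}`-class BHK slack of `(h, o)`. -/
def ThreeMarkOne [DecidableEq V] (ends : E → Sym2 V) (a₁ a₂ b o v : V) : Prop :=
  ∀ (p : E → R), IsProbVec p →
    cell p ends a₁ a₂ b o v false true true * cell p ends a₁ a₂ b o v true false false +
        cell p ends a₁ a₂ b o v true true true * cell p ends a₁ a₂ b o v false false false +
        2 * (cell p ends a₁ a₂ b o v true false false * cell p ends a₁ a₂ b o v true true true) ≤
      cell p ends a₁ a₂ b o v true false true * cell p ends a₁ a₂ b o v false true false +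
        cell p ends a₁ a₂ b o v false false true * cell p ends a₁ a₂ b o v true true false +
        2 * (cell p ends a₁ a₂ b o v true true false * cell p ends a₁ a₂ b o v true false true)

omit [LinearOrder R] [IsStrictOrderedRing R] in
/-- **The (3M1)-slack is `M(1_{v ∈ C₂}, 1)`** at `s = a₂`, `X = Y = {a₁}`, `F = 1 − g_b`,
`G = 1_{o ∈ ·}`. -/
theorem threeMarkOne_slack_eq_mixedForm [Fintype V] [DecidableEq V] (p : E → R)
    (ends : E → Sym2 V) (a₁ a₂ b o v : V) :
    mixedFormW p ends a₂ {a₁} {a₁} (fun W => 1 - delClusterProb p ends a₁ {U | b ∈ U} W)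
        ({W | o ∈ W}.indicator 1) ((connEvent ends a₂ v).indicator 1) (fun _ => 1) =
      cell p ends a₁ a₂ b o v true false true * cell p ends a₁ a₂ b o v false true false +
        cell p ends a₁ a₂ b o v false false true * cell p ends a₁ a₂ b o v true true false +
        2 * (cell p ends a₁ a₂ b o v true true false * cell p ends a₁ a₂ b o v true false true) -
        (cell p ends a₁ a₂ b o v false true true * cell p ends a₁ a₂ b o v true false false +
          cell p ends a₁ a₂ b o v true true true * cell p ends a₁ a₂ b o v false false false +
          2 * (cell p ends a₁ a₂ b o v true false false * cell p ends a₁ a₂ b o v true true true)) := by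
  rw [mixedForm_one_eq, threeMark_slack_eq_mixedForm, connEvent_eq_clusterInEvent]
  unfold bhkFormW
  simp only [Finset.inter_self, Finset.union_self]
  have ha : a₁ ∈ ({a₁} : Finset V) := Finset.mem_singleton_self a₁
  rw [wExpect_one_sub_del_indicator p ends a₂ a₁ ha, wExpect_one_indicator,
    wExpect_one_sub_del p ends a₂ a₁ ha, wExpect_indicator_indicator,
    massPS_ov p ends a₁ a₂ b o v, massPS_ov_b p ends a₁ a₂ b o v, massPS_v p ends a₁ a₂ b o v,
    massPS_v_b p ends a₁ a₂ b o v]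
  ring

omit [Fintype E] [DecidableEq E] [LinearOrder R] [IsStrictOrderedRing R] in
/-- **(3M1) = (3M) + 2·(class-`v` slack)** in the cells (a ring identity). -/
theorem threeMarkOne_slack_eq (m : Bool → Bool → Bool → R) :
    m true false true * m false true false + m false false true * m true true false +
        2 * (m true true false * m true false true) -
        (m false true true * m true false false + m true true true * m false false false +
          2 * (m true false false * m true true true)) =
      (m true false true * m false true false + m false false true * m true true false -
          m false true true * m true false false - m true true true * m false false false) +
        2 * (m true true false * m true false true - m true false false * m true true true) := by
  ring

/-- **(PS1) ⟹ (3M1)**: the second point-split candidate at the source `a₂` implies `ThreeMarkOne`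
for every marking `(a₁, b, o, v)`. -/
theorem threeMarkOne_of_pointSplitBHKOne [Fintype V] [DecidableEq V] (ends : E → Sym2 V)
    (a₁ a₂ b o v : V) (h : PointSplitBHKOne (R := R) ends a₂) :
    ThreeMarkOne (R := R) ends a₁ a₂ b o v := by
  intro p hp
  have hg := delClusterProb_anti p hp ends a₁ (isUpperSet_mem_setOf b)
  have hF : Monotone (fun W => 1 - delClusterProb p ends a₁ {U | b ∈ U} W) := by
    intro W W' hWW'
    simp only
    linarith [hg hWW']
  have hF0 : ∀ S, 0 ≤ (fun W => 1 - delClusterProb p ends a₁ {U | b ∈ U} W) S := by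
    intro S
    simp only
    linarith [delClusterProb_le_one p hp ends a₁ {U | b ∈ U} S]
  have hG : Monotone ({W : Set V | o ∈ W}.indicator (1 : Set V → R)) :=
    monotone_indicator_one_of_isUpperSet (isUpperSet_mem_setOf o)
  have hG0 : ∀ S, 0 ≤ {W : Set V | o ∈ W}.indicator (1 : Set V → R) S :=
    fun S => Set.indicator_apply_nonneg fun _ => zero_le_one
  have key := h p hp {a₁} {a₁} v _ _ hF hG hF0 hG0
  rw [threeMarkOne_slack_eq_mixedForm] at key
  linarith [key]

end PointSplit

end CovForm

end Summit.Ventures.PercRepro2
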